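import Summits.QuantumFields.YangMills.Theorems.FluctuationComparisonRegPrIntLOrganTangentGoodSetTailAlongPath
import HarnessLib

/-!
# Route `UnitScaleTilt` — crux `FluctuationComparisonRegPrIntL` (stmt-QuantumFields-20520, rung R3), PATH-B organ: «THE GOOD-SET TAIL ALONG THE PATH —
# MEAN-SHIFT EDITION»: the exponent `min(t·J₀, (1−t)·J₁)` of ✓`…OrganTangentGoodSetTailAlongPath` is at most `t(1−t)·(m₁ − m₀) ≤ |m₁ − m₀|∕4`,
# `m₀, m₁` the means of `h = log ρ_Ts∘Φ − log ρ′_Ts∘Φ` under the two ENDPOINT fibre laws (SPEC (xv-b) «A5 TAIL THRESHOLD», the `J`-letter)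

Cell `ym3-torus` (YM ladder rung R3 = continuum `SU(2)` Yang–Mills on the three-torus — a RUNG: NOT d = 4, NOT infinite volume, NOT a mass gap, NOT Clay).
Width seat `ym3-torus-px19` (gen 24; WIDTH COPY «width 19» of ★p1), Jensen-lane reading of LEAD `ym-ust-20520-w3` g28 №60∕№63 («`J₀`, `J₁` are the gaps of `±h`
under `ŵ₀`, `ŵ₁`»); `--kind proof --supports stmt-QuantumFields-20520 --as helper`, count-neutral, DEFINITION-FREE, no registry ∕ binder ∕ `Lines/` edit, default
heartbeats, `autoImplicit false`.

WHAT.  ✓`…OrganTangentGoodSetTailAlongPath.setIntegral_wgt_le_max_mul_exp` (w4 g26) bounds the `ŵ_t`-mass of a fibre event by the larger endpoint mass times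
`exp(min(t·J₀, (1−t)·J₁))`, `J₀ = log(Z₁∕Z₀) − m₀`, `J₁ = log(Z₀∕Z₁) + m₁` (`Zᵢ = ∫ wNumᵢ dτ`, `mᵢ = (∫ wNumᵢ·h dτ)∕Zᵢ`).  Two remarks of pure bookkeeping:

* §1 `gap_add_gap_eq_sub`: **`J₀ + J₁ = m₁ − m₀`** — the logarithms cancel (for probability laws: `J₀ = KL(ŵ₀‖ŵ₁)`, `J₁ = KL(ŵ₁‖ŵ₀)`, and their sum, the
  symmetrised relative entropy, is the MEAN SHIFT of `h`; along the exponential path it equals `∫₀¹ Var_{ŵ_s}(h) ds` — path-variance currency, cf. the tree's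
  ✓`OrganTangentJensenGapTools.cgf_one_sub_cgf_zero_sub_deriv_eq_integral_variance` for the `J₀ = ∫₀¹ (1−s)·Var_s ds` half);
  `min_gap_le_mul_meanShift`: `min` is below the `(1−t, t)` convex combination, so **`min(t·J₀, (1−t)·J₁) ≤ t(1−t)·(m₁ − m₀)`** (sign-free);
  `mul_meanShift_le_abs_div_four` ∕ `min_gap_le_abs_meanShift_div_four`: `≤ |m₁ − m₀|∕4`, t-FREE.
* §2 ★`setIntegral_wgt_le_max_mul_exp_meanShift` (binders = w4's theorem VERBATIM; conclusion with `exp(t(1−t)·(m₁ − m₀))`, `m₀, m₁` DISPLAYED as integrals),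
  `setIntegral_wgt_le_max_mul_exp_abs_meanShift` (`exp(|m₁ − m₀|∕4)`), and the A5-door shape `setIntegral_wgt_le_of_endpointTails_meanShift`: from endpoint tail
  letters `∫_A ŵ₀ ≤ ES₀`, `∫_A ŵ₁ ≤ ES₁` and ONE mean-shift letter `|m₁ − m₀| ≤ J♯`, the pair `0 ≤ ES ∧ ∫_A ŵ_t ≤ ES` with `ES := max ES₀ ES₁ · exp(J♯∕4)` for
  EVERY `t ∈ [0,1]` — the `(hES, htail)` slot of the A5 door ✓`…OrganTangentJTSqOfHdispCrude.jtBracket_sq_of_hdisp_crude`.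

WHY (DISCHARGE-SPEC v1.11 §11 (xv-b); LEAD RULINGS №58∕№59; LEAD №60∕№63).  After w4's reduction the (xv-b) clause needs the two ENDPOINT tails (print's conditional
fibre laws, [Balaban1985UV3] (71)-type) and a `J`-letter controlling `min(t·J₀,(1−t)·J₁)` for every `t`.  This file names that letter in its cheapest t-uniform form:
the MEAN SHIFT `m₁ − m₀` of `h` between the two genuine conditional laws — a first-moment difference (equivalently an integrated fibre VARIANCE of `h` along the
path), the same second-order object the JVAR∘∕JENᵘ lane presents; no sup-norm of `h`, no row edition (ROW-sq v0.4ᴱ of record untouched).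

HONEST FRAMING: [folklore] real algebra + monotonicity of `exp` over w4's kernel-checked corollary; nothing of Bałaban's analysis ((71) included) is asserted or
proved; (xv-b) is NOT discharged (the endpoint tails `ES₀, ES₁` and the mean-shift letter `J♯` remain to be supplied); `SpreadFibreLawHJ(sq)`(ᴱ) ∕
`OrganDischargeInputsHJ(sq)` (every edition) UNDISCHARGED; the five registered stubs of `Lines/runpair_organ.lean` (registry 3732b7df, untouched), crux 20520 and
`YM3TorusSU2` are NOT proved; rung R3 = SU(2) YM₃ on T³ at fixed lattice data — NOT d = 4, NOT infinite volume, NOT a mass gap, NOT Clay; the Yang–Mills mass gap is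
NOT proved.
-/

set_option autoImplicit false

noncomputable section

namespace Summit.QuantumFields.YangMills.Theorems.OrganTangentGoodSetTailMeanShift

open MeasureTheory
open scoped ENNReal NNReal
open Literature.MathematicalPhysics.QuantumFieldTheory.Balaban1983to89 T3ContinuumYM3Torus T3NestedUnitLaws
  T3UnitLawDensityEML T4Continuum T3UnitScaleTilt T3LevelShift T3TiltDescent
open Summit.QuantumFields.YangMills.Theorems.FluctuationComparisonRegPrIntLRunpairOrganFibreLaw (mwCut wNum wgt)
open Summit.QuantumFields.YangMills.Theorems.OrganTangentFibreWeightNormalisation (wgt_nonneg)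
open Summit.QuantumFields.YangMills.Theorems.OrganTangentGoodSetTailAlongPath (setIntegral_wgt_le_max_mul_exp)

/-! ## §1 Scalar bookkeeping: the two gaps sum to the mean shift; `min` ≤ convex combination -/

/-- The two «Jensen-gap» exponents of the tilted-path bound sum to the MEAN SHIFT: with `J₀ = log(Z₁∕Z₀) − m₀`, `J₁ = log(Z₀∕Z₁) + m₁`
one has `J₀ + J₁ = m₁ − m₀` — the logarithms cancel (Mathlib's `Real.log` makes this true for ALL reals `Z₀, Z₁`, no positivity needed).
When `Z₀, Z₁ > 0` are the normalisers of the endpoint weights and `mᵢ` the endpoint means of `h`, `J₀ = KL(ŵ₀ ‖ ŵ₁)`, `J₁ = KL(ŵ₁ ‖ ŵ₀)` and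
`m₁ − m₀` is their sum, the symmetrised relative entropy. [folklore] -/
theorem gap_add_gap_eq_sub (Z₀ Z₁ m₀ m₁ : ℝ) :
    (Real.log (Z₁ / Z₀) - m₀) + (Real.log (Z₀ / Z₁) + m₁) = m₁ - m₀ := by
  have hℓ : Real.log (Z₀ / Z₁) = -Real.log (Z₁ / Z₀) := by
    rw [← Real.log_inv, inv_div]
  rw [hℓ]; ring

/-- `min` is below every convex combination: for `t ∈ [0,1]`, `min (t·J₀) ((1−t)·J₁) ≤ (1−t)·(t·J₀) + t·((1−t)·J₁) = t(1−t)·(J₀ + J₁)`; with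
`J₀ = log(Z₁∕Z₀) − m₀`, `J₁ = log(Z₀∕Z₁) + m₁` this is `t(1−t)·(m₁ − m₀)` — the exponent of the tilted-path event bound is controlled, UNIFORMLY IN `t`,
by the mean shift `m₁ − m₀` alone (no sign hypothesis, no positivity of `Z₀, Z₁` needed). [folklore] -/
theorem min_gap_le_mul_meanShift (Z₀ Z₁ m₀ m₁ : ℝ) {t : ℝ} (ht0 : 0 ≤ t) (ht1 : t ≤ 1) :
    min (t * (Real.log (Z₁ / Z₀) - m₀)) ((1 - t) * (Real.log (Z₀ / Z₁) + m₁)) ≤ t * (1 - t) * (m₁ - m₀) := by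
  set a : ℝ := t * (Real.log (Z₁ / Z₀) - m₀) with ha
  set b : ℝ := (1 - t) * (Real.log (Z₀ / Z₁) + m₁) with hb
  have h1 : (1 - t) * min a b ≤ (1 - t) * a := mul_le_mul_of_nonneg_left (min_le_left a b) (sub_nonneg.2 ht1)
  have h2 : t * min a b ≤ t * b := mul_le_mul_of_nonneg_left (min_le_right a b) ht0
  have hsum : min a b = (1 - t) * min a b + t * min a b := by ring
  have hcomb : (1 - t) * a + t * b = t * (1 - t) * (m₁ - m₀) := by
    have e := gap_add_gap_eq_sub Z₀ Z₁ m₀ m₁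
    rw [ha, hb]
    have : (1 - t) * (t * (Real.log (Z₁ / Z₀) - m₀)) + t * ((1 - t) * (Real.log (Z₀ / Z₁) + m₁))
        = t * (1 - t) * ((Real.log (Z₁ / Z₀) - m₀) + (Real.log (Z₀ / Z₁) + m₁)) := by ring
    rw [this, e]
  calc min a b = (1 - t) * min a b + t * min a b := hsum
    _ ≤ (1 - t) * a + t * b := add_le_add h1 h2
    _ = t * (1 - t) * (m₁ - m₀) := hcomb

/-- The t-free edition: `t(1−t) ≤ 1∕4` on `[0,1]`, so `t(1−t)·(m₁ − m₀) ≤ |m₁ − m₀|∕4` (sign-free). [folklore] -/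
theorem mul_meanShift_le_abs_div_four (m₀ m₁ : ℝ) {t : ℝ} (ht0 : 0 ≤ t) (ht1 : t ≤ 1) :
    t * (1 - t) * (m₁ - m₀) ≤ |m₁ - m₀| / 4 := by
  have hq : t * (1 - t) ≤ 1 / 4 := by nlinarith [sq_nonneg (2 * t - 1)]
  have hq0 : 0 ≤ t * (1 - t) := mul_nonneg ht0 (sub_nonneg.2 ht1)
  calc t * (1 - t) * (m₁ - m₀) ≤ t * (1 - t) * |m₁ - m₀| := mul_le_mul_of_nonneg_left (le_abs_self _) hq0
    _ ≤ 1 / 4 * |m₁ - m₀| := mul_le_mul_of_nonneg_right hq (abs_nonneg _)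
    _ = |m₁ - m₀| / 4 := by ring

/-- Combined: `min (t·J₀) ((1−t)·J₁) ≤ |m₁ − m₀|∕4` for `t ∈ [0,1]`. [folklore] -/
theorem min_gap_le_abs_meanShift_div_four (Z₀ Z₁ m₀ m₁ : ℝ) {t : ℝ} (ht0 : 0 ≤ t) (ht1 : t ≤ 1) :
    min (t * (Real.log (Z₁ / Z₀) - m₀)) ((1 - t) * (Real.log (Z₀ / Z₁) + m₁)) ≤ |m₁ - m₀| / 4 :=
  (min_gap_le_mul_meanShift Z₀ Z₁ m₀ m₁ ht0 ht1).trans (mul_meanShift_le_abs_div_four m₀ m₁ ht0 ht1)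

/-! ## §2 The good-set tail along the path, MEAN-SHIFT edition (the `wgt` letters of the A5 door) -/

/-- ★ «THE GOOD-SET TAIL ALONG THE PATH — MEAN-SHIFT EDITION».  Binders = ✓`…OrganTangentGoodSetTailAlongPath.setIntegral_wgt_le_max_mul_exp`'s VERBATIM
(= ✓`wgt_normalised`'s frame, then `t ∈ [0,1]`, a window point `V`, a measurable fibre event `A`).  With `h(z) := log ρ_Ts(Φ(V,z)) − log ρ′_Ts(Φ(V,z))` and the
two ENDPOINT MEANS `m₀ := (∫ wNum₀·h dτ)∕∫ wNum₀ dτ` (mean of `h` under `ŵ₀ ∝ χ·ρ′_Ts·J`) and `m₁ := (∫ wNum₁·h dτ)∕∫ wNum₁ dτ` (under `ŵ₁ ∝ χ·ρ_Ts·J`),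
DISPLAYED as integrals:

  `∫_A ŵ_t(V,·) dτ ≤ max(∫_A ŵ₀(V,·) dτ, ∫_A ŵ₁(V,·) dτ) · exp(t(1−t)·(m₁ − m₀))`.

Proof: w4's ★★`setIntegral_wgt_le_max_mul_exp` gives the factor `exp(min(t·J₀, (1−t)·J₁))`; §1 `min_gap_le_mul_meanShift` (`J₀ + J₁ = m₁ − m₀`, `min` ≤ the
`(1−t, t)` convex combination) and monotonicity of `exp`.  So the (xv-b) exponent is ONE t-free letter: the MEAN SHIFT of `h` between the two genuine conditional
fibre laws (`= KL(ŵ₀‖ŵ₁) + KL(ŵ₁‖ŵ₀) = ∫₀¹ Var_{ŵ_s}(h) ds`, path-variance currency — not a sup-norm of `h`). [folklore] -/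
theorem setIntegral_wgt_le_max_mul_exp_meanShift (F : T3Family) (γ b₀ p₀ : ℝ) (j Ts : ℕ) (hjTs : j + 1 ≤ Ts)
    (ρ ρ' : (i : ℕ) → GaugeField (F.P i) 0 ↥(Matrix.specialUnitaryGroup (Fin 2) ℂ) → ℝ)
    (hρm : Measurable (ρ Ts)) (hρ'm : Measurable (ρ' Ts))
    (hρc : ContinuousOn (ρ Ts) {U | PlaqSmall (θBal F.L γ b₀ p₀ Ts) U}) (hρ'c : ContinuousOn (ρ' Ts) {U | PlaqSmall (θBal F.L γ b₀ p₀ Ts) U})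
    (hρpos : ∀ U, PlaqSmall (θBal F.L γ b₀ p₀ Ts) U → 0 < ρ Ts U ∧ 0 < ρ' Ts U)
    (hθ : 0 < θBal F.L γ b₀ p₀ Ts)
    (hχc : Continuous (mwCut F γ b₀ p₀ j Ts)) (hχ0 : ∀ U, 0 ≤ mwCut F γ b₀ p₀ j Ts U)
    (hχsupp : ∀ U, mwCut F γ b₀ p₀ j Ts U ≠ 0 → ∀ (n : ℕ) (hjn : j + 1 ≤ n) (hnK : n ≤ Ts), PlaqSmall (24 / 25 * θBal F.L γ b₀ p₀ n) (descendTo F ℰp n Ts hnK U))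
    (hχpos : ∀ U, (∀ (n : ℕ) (hjn : j + 1 ≤ n) (hnK : n ≤ Ts), PlaqSmall (24 / 25 * θBal F.L γ b₀ p₀ n) (descendTo F ℰp n Ts hnK U)) → 0 < mwCut F γ b₀ p₀ j Ts U)
    {Z : Type} [MeasurableSpace Z] (τ : Measure Z) [IsProbabilityMeasure τ]
    (Φ : GaugeField (F.P j) 0 ↥(Matrix.specialUnitaryGroup (Fin 2) ℂ) × Z → GaugeField (F.P Ts) 0 ↥(Matrix.specialUnitaryGroup (Fin 2) ℂ))
    (J : GaugeField (F.P j) 0 ↥(Matrix.specialUnitaryGroup (Fin 2) ℂ) × Z → ℝ≥0)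
    (hΦm : Measurable Φ) (hJm : Measurable J) (CJ : ℝ) (hJle : ∀ V z, (J (V, z) : ℝ) ≤ CJ)
    (hpos : ∀ V, PlaqSmall (θBal F.L γ b₀ p₀ j) V →
      0 < ∫⁻ z in {z | (∀ (n : ℕ) (hjn : j + 1 ≤ n) (hnK : n ≤ Ts), PlaqSmall (24 / 25 * θBal F.L γ b₀ p₀ n) (descendTo F ℰp n Ts hnK (Φ (V, z))))},
        (J (V, z) : ℝ≥0∞) ∂τ)
    (t : ℝ) (ht0 : 0 ≤ t) (ht1 : t ≤ 1)
    (V : GaugeField (F.P j) 0 ↥(Matrix.specialUnitaryGroup (Fin 2) ℂ)) (hV : PlaqSmall (θBal F.L γ b₀ p₀ j) V)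
    {A : Set Z} (hA : MeasurableSet A) :
    ∫ z in A, wgt F γ b₀ p₀ j Ts ρ ρ' τ Φ J t V z ∂τ
      ≤ max (∫ z in A, wgt F γ b₀ p₀ j Ts ρ ρ' τ Φ J 0 V z ∂τ) (∫ z in A, wgt F γ b₀ p₀ j Ts ρ ρ' τ Φ J 1 V z ∂τ)
        * Real.exp (t * (1 - t) *
            ((∫ z, wNum F γ b₀ p₀ j Ts ρ ρ' Φ J 1 V z * (Real.log (ρ Ts (Φ (V, z))) - Real.log (ρ' Ts (Φ (V, z)))) ∂τ)
                / (∫ z, wNum F γ b₀ p₀ j Ts ρ ρ' Φ J 1 V z ∂τ)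
              - (∫ z, wNum F γ b₀ p₀ j Ts ρ ρ' Φ J 0 V z * (Real.log (ρ Ts (Φ (V, z))) - Real.log (ρ' Ts (Φ (V, z)))) ∂τ)
                / (∫ z, wNum F γ b₀ p₀ j Ts ρ ρ' Φ J 0 V z ∂τ))) := by
  have hw := setIntegral_wgt_le_max_mul_exp F γ b₀ p₀ j Ts hjTs ρ ρ' hρm hρ'm hρc hρ'c hρpos hθ hχc hχ0 hχsupp hχpos τ Φ J hΦm hJm CJ hJle hpos
    t ht0 ht1 V hV hA
  refine hw.trans (mul_le_mul_of_nonneg_left (Real.exp_le_exp.2 (min_gap_le_mul_meanShift _ _ _ _ ht0 ht1)) ?_)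
  exact le_max_of_le_left (setIntegral_nonneg hA fun z _ => wgt_nonneg F γ b₀ p₀ j Ts hjTs ρ ρ' hρpos hθ hχ0 hχsupp τ Φ J 0 V z)

/-- The t-FREE edition: `∫_A ŵ_t(V,·) dτ ≤ max(∫_A ŵ₀, ∫_A ŵ₁) · exp(|m₁ − m₀|∕4)` for every `t ∈ [0,1]` (`t(1−t) ≤ 1∕4`).  USE FOR (xv-b): the A5 door's
`(htail : ∫_{Goodᶜ} wgt … t Xw ≤ ES)` is met for EVERY `t` by `ES := max(ES₀, ES₁) · exp(J♯∕4)` from the two ENDPOINT tails `∫_{Goodᶜ} ŵ₀ ≤ ES₀`,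
`∫_{Goodᶜ} ŵ₁ ≤ ES₁` (print's conditional fibre laws) and ONE mean-shift letter `|m₁ − m₀| ≤ J♯`. [folklore] -/
theorem setIntegral_wgt_le_max_mul_exp_abs_meanShift (F : T3Family) (γ b₀ p₀ : ℝ) (j Ts : ℕ) (hjTs : j + 1 ≤ Ts)
    (ρ ρ' : (i : ℕ) → GaugeField (F.P i) 0 ↥(Matrix.specialUnitaryGroup (Fin 2) ℂ) → ℝ)
    (hρm : Measurable (ρ Ts)) (hρ'm : Measurable (ρ' Ts))
    (hρc : ContinuousOn (ρ Ts) {U | PlaqSmall (θBal F.L γ b₀ p₀ Ts) U}) (hρ'c : ContinuousOn (ρ' Ts) {U | PlaqSmall (θBal F.L γ b₀ p₀ Ts) U})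
    (hρpos : ∀ U, PlaqSmall (θBal F.L γ b₀ p₀ Ts) U → 0 < ρ Ts U ∧ 0 < ρ' Ts U)
    (hθ : 0 < θBal F.L γ b₀ p₀ Ts)
    (hχc : Continuous (mwCut F γ b₀ p₀ j Ts)) (hχ0 : ∀ U, 0 ≤ mwCut F γ b₀ p₀ j Ts U)
    (hχsupp : ∀ U, mwCut F γ b₀ p₀ j Ts U ≠ 0 → ∀ (n : ℕ) (hjn : j + 1 ≤ n) (hnK : n ≤ Ts), PlaqSmall (24 / 25 * θBal F.L γ b₀ p₀ n) (descendTo F ℰp n Ts hnK U))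
    (hχpos : ∀ U, (∀ (n : ℕ) (hjn : j + 1 ≤ n) (hnK : n ≤ Ts), PlaqSmall (24 / 25 * θBal F.L γ b₀ p₀ n) (descendTo F ℰp n Ts hnK U)) → 0 < mwCut F γ b₀ p₀ j Ts U)
    {Z : Type} [MeasurableSpace Z] (τ : Measure Z) [IsProbabilityMeasure τ]
    (Φ : GaugeField (F.P j) 0 ↥(Matrix.specialUnitaryGroup (Fin 2) ℂ) × Z → GaugeField (F.P Ts) 0 ↥(Matrix.specialUnitaryGroup (Fin 2) ℂ))
    (J : GaugeField (F.P j) 0 ↥(Matrix.specialUnitaryGroup (Fin 2) ℂ) × Z → ℝ≥0)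
    (hΦm : Measurable Φ) (hJm : Measurable J) (CJ : ℝ) (hJle : ∀ V z, (J (V, z) : ℝ) ≤ CJ)
    (hpos : ∀ V, PlaqSmall (θBal F.L γ b₀ p₀ j) V →
      0 < ∫⁻ z in {z | (∀ (n : ℕ) (hjn : j + 1 ≤ n) (hnK : n ≤ Ts), PlaqSmall (24 / 25 * θBal F.L γ b₀ p₀ n) (descendTo F ℰp n Ts hnK (Φ (V, z))))},
        (J (V, z) : ℝ≥0∞) ∂τ)
    (t : ℝ) (ht0 : 0 ≤ t) (ht1 : t ≤ 1)
    (V : GaugeField (F.P j) 0 ↥(Matrix.specialUnitaryGroup (Fin 2) ℂ)) (hV : PlaqSmall (θBal F.L γ b₀ p₀ j) V)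
    {A : Set Z} (hA : MeasurableSet A) :
    ∫ z in A, wgt F γ b₀ p₀ j Ts ρ ρ' τ Φ J t V z ∂τ
      ≤ max (∫ z in A, wgt F γ b₀ p₀ j Ts ρ ρ' τ Φ J 0 V z ∂τ) (∫ z in A, wgt F γ b₀ p₀ j Ts ρ ρ' τ Φ J 1 V z ∂τ)
        * Real.exp (|(∫ z, wNum F γ b₀ p₀ j Ts ρ ρ' Φ J 1 V z * (Real.log (ρ Ts (Φ (V, z))) - Real.log (ρ' Ts (Φ (V, z)))) ∂τ)
                / (∫ z, wNum F γ b₀ p₀ j Ts ρ ρ' Φ J 1 V z ∂τ)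
              - (∫ z, wNum F γ b₀ p₀ j Ts ρ ρ' Φ J 0 V z * (Real.log (ρ Ts (Φ (V, z))) - Real.log (ρ' Ts (Φ (V, z)))) ∂τ)
                / (∫ z, wNum F γ b₀ p₀ j Ts ρ ρ' Φ J 0 V z ∂τ)| / 4) := by
  have hw := setIntegral_wgt_le_max_mul_exp_meanShift F γ b₀ p₀ j Ts hjTs ρ ρ' hρm hρ'm hρc hρ'c hρpos hθ hχc hχ0 hχsupp hχpos τ Φ J hΦm hJm CJ hJle
    hpos t ht0 ht1 V hV hA
  refine hw.trans (mul_le_mul_of_nonneg_left (Real.exp_le_exp.2 (mul_meanShift_le_abs_div_four _ _ ht0 ht1)) ?_)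
  exact le_max_of_le_left (setIntegral_nonneg hA fun z _ => wgt_nonneg F γ b₀ p₀ j Ts hjTs ρ ρ' hρpos hθ hχ0 hχsupp τ Φ J 0 V z)

/-- The A5-door shape, spelled out: from the two ENDPOINT tail letters `∫_{A} ŵ₀ ≤ ES₀`, `∫_{A} ŵ₁ ≤ ES₁` and a mean-shift letter `|m₁ − m₀| ≤ Jsharp`,
the t-uniform tail `∫_A ŵ_t ≤ max ES₀ ES₁ · exp(Jsharp∕4)` for every `t ∈ [0,1]` — i.e. the `htail`∕`hES` pair of ✓`…OrganTangentJTSqOfHdispCrude.jtBracket_sq_of_hdisp_crude`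
with `ES := max ES₀ ES₁ · exp(Jsharp∕4)` (`0 ≤ ES` from `0 ≤ ES₀`). [folklore] -/
theorem setIntegral_wgt_le_of_endpointTails_meanShift (F : T3Family) (γ b₀ p₀ : ℝ) (j Ts : ℕ) (hjTs : j + 1 ≤ Ts)
    (ρ ρ' : (i : ℕ) → GaugeField (F.P i) 0 ↥(Matrix.specialUnitaryGroup (Fin 2) ℂ) → ℝ)
    (hρm : Measurable (ρ Ts)) (hρ'm : Measurable (ρ' Ts))
    (hρc : ContinuousOn (ρ Ts) {U | PlaqSmall (θBal F.L γ b₀ p₀ Ts) U}) (hρ'c : ContinuousOn (ρ' Ts) {U | PlaqSmall (θBal F.L γ b₀ p₀ Ts) U})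
    (hρpos : ∀ U, PlaqSmall (θBal F.L γ b₀ p₀ Ts) U → 0 < ρ Ts U ∧ 0 < ρ' Ts U)
    (hθ : 0 < θBal F.L γ b₀ p₀ Ts)
    (hχc : Continuous (mwCut F γ b₀ p₀ j Ts)) (hχ0 : ∀ U, 0 ≤ mwCut F γ b₀ p₀ j Ts U)
    (hχsupp : ∀ U, mwCut F γ b₀ p₀ j Ts U ≠ 0 → ∀ (n : ℕ) (hjn : j + 1 ≤ n) (hnK : n ≤ Ts), PlaqSmall (24 / 25 * θBal F.L γ b₀ p₀ n) (descendTo F ℰp n Ts hnK U))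
    (hχpos : ∀ U, (∀ (n : ℕ) (hjn : j + 1 ≤ n) (hnK : n ≤ Ts), PlaqSmall (24 / 25 * θBal F.L γ b₀ p₀ n) (descendTo F ℰp n Ts hnK U)) → 0 < mwCut F γ b₀ p₀ j Ts U)
    {Z : Type} [MeasurableSpace Z] (τ : Measure Z) [IsProbabilityMeasure τ]
    (Φ : GaugeField (F.P j) 0 ↥(Matrix.specialUnitaryGroup (Fin 2) ℂ) × Z → GaugeField (F.P Ts) 0 ↥(Matrix.specialUnitaryGroup (Fin 2) ℂ))
    (J : GaugeField (F.P j) 0 ↥(Matrix.specialUnitaryGroup (Fin 2) ℂ) × Z → ℝ≥0)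
    (hΦm : Measurable Φ) (hJm : Measurable J) (CJ : ℝ) (hJle : ∀ V z, (J (V, z) : ℝ) ≤ CJ)
    (hpos : ∀ V, PlaqSmall (θBal F.L γ b₀ p₀ j) V →
      0 < ∫⁻ z in {z | (∀ (n : ℕ) (hjn : j + 1 ≤ n) (hnK : n ≤ Ts), PlaqSmall (24 / 25 * θBal F.L γ b₀ p₀ n) (descendTo F ℰp n Ts hnK (Φ (V, z))))},
        (J (V, z) : ℝ≥0∞) ∂τ)
    (t : ℝ) (ht0 : 0 ≤ t) (ht1 : t ≤ 1)
    (V : GaugeField (F.P j) 0 ↥(Matrix.specialUnitaryGroup (Fin 2) ℂ)) (hV : PlaqSmall (θBal F.L γ b₀ p₀ j) V)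
    {A : Set Z} (hA : MeasurableSet A)
    {ES₀ ES₁ Jsharp : ℝ} (hES₀ : 0 ≤ ES₀)
    (htail₀ : ∫ z in A, wgt F γ b₀ p₀ j Ts ρ ρ' τ Φ J 0 V z ∂τ ≤ ES₀)
    (htail₁ : ∫ z in A, wgt F γ b₀ p₀ j Ts ρ ρ' τ Φ J 1 V z ∂τ ≤ ES₁)
    (hshift : |(∫ z, wNum F γ b₀ p₀ j Ts ρ ρ' Φ J 1 V z * (Real.log (ρ Ts (Φ (V, z))) - Real.log (ρ' Ts (Φ (V, z)))) ∂τ)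
                / (∫ z, wNum F γ b₀ p₀ j Ts ρ ρ' Φ J 1 V z ∂τ)
              - (∫ z, wNum F γ b₀ p₀ j Ts ρ ρ' Φ J 0 V z * (Real.log (ρ Ts (Φ (V, z))) - Real.log (ρ' Ts (Φ (V, z)))) ∂τ)
                / (∫ z, wNum F γ b₀ p₀ j Ts ρ ρ' Φ J 0 V z ∂τ)| ≤ Jsharp) :
    0 ≤ max ES₀ ES₁ * Real.exp (Jsharp / 4) ∧
    ∫ z in A, wgt F γ b₀ p₀ j Ts ρ ρ' τ Φ J t V z ∂τ ≤ max ES₀ ES₁ * Real.exp (Jsharp / 4) := by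
  refine ⟨mul_nonneg (le_max_of_le_left hES₀) (Real.exp_pos _).le, ?_⟩
  have hw := setIntegral_wgt_le_max_mul_exp_abs_meanShift F γ b₀ p₀ j Ts hjTs ρ ρ' hρm hρ'm hρc hρ'c hρpos hθ hχc hχ0 hχsupp hχpos τ Φ J hΦm hJm CJ
    hJle hpos t ht0 ht1 V hV hA
  refine hw.trans ?_
  have hmax : max (∫ z in A, wgt F γ b₀ p₀ j Ts ρ ρ' τ Φ J 0 V z ∂τ) (∫ z in A, wgt F γ b₀ p₀ j Ts ρ ρ' τ Φ J 1 V z ∂τ) ≤ max ES₀ ES₁ :=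
    max_le_max htail₀ htail₁
  have hexp : Real.exp (|(∫ z, wNum F γ b₀ p₀ j Ts ρ ρ' Φ J 1 V z * (Real.log (ρ Ts (Φ (V, z))) - Real.log (ρ' Ts (Φ (V, z)))) ∂τ)
                / (∫ z, wNum F γ b₀ p₀ j Ts ρ ρ' Φ J 1 V z ∂τ)
              - (∫ z, wNum F γ b₀ p₀ j Ts ρ ρ' Φ J 0 V z * (Real.log (ρ Ts (Φ (V, z))) - Real.log (ρ' Ts (Φ (V, z)))) ∂τ)
                / (∫ z, wNum F γ b₀ p₀ j Ts ρ ρ' Φ J 0 V z ∂τ)| / 4) ≤ Real.exp (Jsharp / 4) :=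
    Real.exp_le_exp.2 (by linarith)
  exact mul_le_mul hmax hexp (Real.exp_pos _).le (le_max_of_le_left hES₀)

end Summit.QuantumFields.YangMills.Theorems.OrganTangentGoodSetTailMeanShift

end
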